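import Mathlib.Algebra.Order.BigOperators.Ring.Finset
import Mathlib.Analysis.SpecialFunctions.Pow.Real
import Mathlib.Data.Fintype.Pi
import Mathlib.Data.Fintype.Prod
import HarnessLib

/-!
# The Lovász Local Lemma — lopsided (asymmetric) form and the variable version, counting form

The LOVÁSZ LOCAL LEMMA in the asymmetric ("general") form of Spencer, with the weakened
independence hypothesis of Erdős–Spencer (the LOPSIDED local lemma), for finitely many events
`A i` (`i ∈ I`) in a finite uniform probability space `Ω` (probabilities are quotients of
cardinalities, so every statement below is an inequality between products of cardinalities and
no measure theory is used):

* `card_inter_avoid_le` — the key inequality `|A i ∩ N S| ≤ x i · |N S|` for `i ∉ S`, where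
  `N S = {ω | ∀ j ∈ S, ω ∉ A j}` is the set of sample points avoiding the events of `S`;
* `lopsided_local_lemma` — `|N I| ≥ (∏ i ∈ I, (1 - x i)) · |Ω|`: if each `A i` is negatively
  correlated with (here: at most independent of) the avoiding sets of its non-neighbours and
  `|A i| ≤ x i · ∏_{j ∈ Γ i} (1 - x j) · |Ω|`, then with positive probability no `A i` occurs
  (`exists_forall_not_mem_of_lopsided`);
* `card_inter_mul_card_le_of_determined` — in a product space `V → κ`, an event determined by the
  coordinates in `T` and an event determined by the coordinates outside `T` satisfy
  `|A ∩ B| · |Ω| ≤ |A| · |B|` (proved by the mixing involution on `Ω × Ω`);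
* `variable_local_lemma`, `exists_forall_not_mem_of_variable` — the VARIABLE VERSION: events
  determined by sets of coordinates `vbl i`, neighbours = events sharing a coordinate.

Design: counting form on `Finset`s of a `Fintype` (the users — restriction arguments in proof
complexity, `Summits/PneNP` — count sample points); the index set of events is a `Finset` of an
arbitrary type. Not here: Shearer's optimal criterion, the Moser–Tardos algorithm, infinite spaces.

References: P. Erdős, L. Lovász, *Problems and results on 3-chromatic hypergraphs and some related
questions*, in: Infinite and finite sets, Colloq. Math. Soc. János Bolyai 10 (1975), 609–627;
J. Spencer, *Asymptotic lower bounds for Ramsey functions*, Discrete Math. 20 (1977), 69–76;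
P. Erdős, J. Spencer, *Lopsided Lovász local lemma and Latin transversals*, Discrete Appl. Math.
30 (1991), 151–154; N. Alon, J. Spencer, *The Probabilistic Method* (4th ed., Wiley 2016),
Lemma 5.1.1 and §5.7.
-/

namespace Literature.Probability.Independence

open Finset

section Lopsided

variable {Ω ι : Type*} [Fintype Ω] [DecidableEq Ω] [DecidableEq ι]

/-- Adding an event to the avoided set removes exactly its trace on the avoiding set:
`|N (insert a S)| + |A a ∩ N S| = |N S|`. [folklore] -/
theorem card_avoid_insert_add (A : ι → Finset Ω) [∀ i, DecidablePred (· ∈ A i)]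
    (S : Finset ι) (a : ι) :
    (univ.filter fun ω => ∀ j ∈ insert a S, ω ∉ A j).card
      + (A a ∩ univ.filter fun ω => ∀ j ∈ S, ω ∉ A j).card
      = (univ.filter fun ω => ∀ j ∈ S, ω ∉ A j).card := by
  classical
  have h1 : (univ.filter fun ω => ∀ j ∈ insert a S, ω ∉ A j)
      = (univ.filter fun ω => ∀ j ∈ S, ω ∉ A j).filter fun ω => ω ∉ A a := by
    ext ω
    simp only [mem_filter, mem_univ, true_and, forall_mem_insert]
    tauto
  have h2 : (A a ∩ univ.filter fun ω => ∀ j ∈ S, ω ∉ A j)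
      = (univ.filter fun ω => ∀ j ∈ S, ω ∉ A j).filter fun ω => ¬ (ω ∉ A a) := by
    ext ω
    simp only [mem_inter, mem_filter, mem_univ, true_and, not_not]
    tauto
  rw [h1, h2]
  exact card_filter_add_card_filter_not _

omit [DecidableEq Ω] [DecidableEq ι] in
/-- Avoiding more events leaves fewer sample points: `S ⊆ S' → N S' ⊆ N S`. [folklore] -/
theorem avoid_subset_avoid (A : ι → Finset Ω) [∀ i, DecidablePred (· ∈ A i)]
    {S S' : Finset ι} (h : S ⊆ S') :
    (univ.filter fun ω => ∀ j ∈ S', ω ∉ A j) ⊆ (univ.filter fun ω => ∀ j ∈ S, ω ∉ A j) := by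
  intro ω hω
  simp only [mem_filter, mem_univ, true_and] at hω ⊢
  exact fun j hj => hω j (h hj)

/-- **The key inequality of the (lopsided) Lovász Local Lemma.** Let `A i` (`i ∈ I`) be events
in a finite uniform space, `Γ i` the "neighbours" of `i`, and `x i ∈ [0, 1]`. Suppose that each
`A i` is at most independent of the avoiding set of any family of non-neighbours
(`|A i ∩ N S| · |Ω| ≤ |A i| · |N S|` for `S ⊆ I ∖ {i}` with `S ∩ Γ i = ∅`) and that
`|A i| ≤ x i · ∏_{j ∈ Γ i} (1 - x j) · |Ω|`. Then `|A i ∩ N S| ≤ x i · |N S|` for every `S ⊆ I`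
and `i ∈ I ∖ S`. Proof by strong induction on `S`, peeling the neighbours of `i` in `S` one at a
time. [cite: AlonSpencer2016, Lemma 5.1.1 (proof) and §5.7] -/
theorem card_inter_avoid_le (A : ι → Finset Ω) [∀ i, DecidablePred (· ∈ A i)]
    (Γ : ι → Finset ι) (x : ι → ℝ) (I : Finset ι)
    (hx0 : ∀ i, 0 ≤ x i) (hx1 : ∀ i, x i ≤ 1)
    (hind : ∀ i ∈ I, ∀ S ⊆ I, i ∉ S → (∀ j ∈ S, j ∉ Γ i) →
      ((A i ∩ univ.filter fun ω => ∀ j ∈ S, ω ∉ A j).card : ℝ) * Fintype.card Ω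
        ≤ (A i).card * (univ.filter fun ω => ∀ j ∈ S, ω ∉ A j).card)
    (hp : ∀ i ∈ I, ((A i).card : ℝ) ≤ x i * (∏ j ∈ Γ i, (1 - x j)) * Fintype.card Ω) :
    ∀ S ⊆ I, ∀ i ∈ I, i ∉ S →
      ((A i ∩ univ.filter fun ω => ∀ j ∈ S, ω ∉ A j).card : ℝ)
        ≤ x i * (univ.filter fun ω => ∀ j ∈ S, ω ∉ A j).card := by
  classical
  -- notation
  set N : Finset ι → Finset Ω := fun S => univ.filter fun ω => ∀ j ∈ S, ω ∉ A j with hN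
  intro S
  induction S using Finset.strongInductionOn with
  | _ S ih =>
    intro hSI i hi hiS
    -- split `S` into neighbours and non-neighbours of `i`
    set S₁ : Finset ι := S.filter fun j => j ∈ Γ i with hS₁
    set S₂ : Finset ι := S.filter fun j => j ∉ Γ i with hS₂
    have hS₂S : S₂ ⊆ S := filter_subset _ _
    have hS₁S : S₁ ⊆ S := filter_subset _ _
    have hunion : S₂ ∪ S₁ = S := by
      rw [hS₂, hS₁, union_comm]; exact filter_union_filter_not_eq _ _
    -- the chain: `|N (S₂ ∪ T)| ≥ ∏_{T} (1 - x) · |N S₂|` for `T ⊆ S₁`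
    have hchain : ∀ T ⊆ S₁,
        (∏ j ∈ T, (1 - x j)) * ((N S₂).card : ℝ) ≤ (N (S₂ ∪ T)).card := by
      intro T
      induction T using Finset.induction_on with
      | empty => intro; simp
      | @insert a T haT ihT =>
        intro haT1
        have hT1 : T ⊆ S₁ := (subset_insert a T).trans haT1
        have ha1 : a ∈ S₁ := haT1 (mem_insert_self a T)
        have haS : a ∈ S := hS₁S ha1
        have haΓ : a ∈ Γ i := (mem_filter.1 ha1).2
        have haS₂ : a ∉ S₂ := fun h => (mem_filter.1 h).2 haΓ
        -- `R = S₂ ∪ T` is a strict subset of `S` not containing `a`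
        set R : Finset ι := S₂ ∪ T with hR
        have hRS : R ⊆ S := union_subset hS₂S (hT1.trans hS₁S)
        have haR : a ∉ R := by
          rw [hR, mem_union, not_or]; exact ⟨haS₂, haT⟩
        have hRss : R ⊂ S := Finset.ssubset_iff_subset_ne.2 ⟨hRS, fun h => haR (h ▸ haS)⟩
        have hstep : ((A a ∩ N R).card : ℝ) ≤ x a * (N R).card :=
          ih R hRss (hRS.trans hSI) a (hSI haS) haR
        have hcard : ((N (insert a R)).card : ℝ) = (N R).card - (A a ∩ N R).card := by
          have h := card_avoid_insert_add A R a
          have h' : ((N (insert a R)).card : ℝ) + (A a ∩ N R).card = (N R).card := by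
            exact_mod_cast h
          linarith
        have hins : S₂ ∪ insert a T = insert a R := by rw [hR, union_insert]
        rw [hins, prod_insert haT, hcard]
        have h1a : 0 ≤ 1 - x a := sub_nonneg.2 (hx1 a)
        calc (1 - x a) * (∏ j ∈ T, (1 - x j)) * ((N S₂).card : ℝ)
            = (1 - x a) * ((∏ j ∈ T, (1 - x j)) * ((N S₂).card : ℝ)) := by ring
          _ ≤ (1 - x a) * (N R).card := mul_le_mul_of_nonneg_left (ihT hT1) h1a
          _ = (N R).card - x a * (N R).card := by ring
          _ ≤ (N R).card - (A a ∩ N R).card := by linarith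
    -- the non-neighbour part: `|A i ∩ N S₂| ≤ x i ∏_{Γ i} (1 - x) |N S₂|`
    have hiS₂ : i ∉ S₂ := fun h => hiS (hS₂S h)
    have hS₂Γ : ∀ j ∈ S₂, j ∉ Γ i := fun j hj => (mem_filter.1 hj).2
    have hind' := hind i hi S₂ (hS₂S.trans hSI) hiS₂ hS₂Γ
    have hprod0 : 0 ≤ ∏ j ∈ Γ i, (1 - x j) :=
      prod_nonneg fun j _ => sub_nonneg.2 (hx1 j)
    have hA2 : ((A i ∩ N S₂).card : ℝ) ≤ x i * (∏ j ∈ Γ i, (1 - x j)) * (N S₂).card := by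
      rcases Nat.eq_zero_or_pos (Fintype.card Ω) with h0 | hpos
      · have : (A i ∩ N S₂).card = 0 :=
          Nat.eq_zero_of_le_zero (h0 ▸ Finset.card_le_univ _)
        rw [this, Nat.cast_zero]
        exact mul_nonneg (mul_nonneg (hx0 i) hprod0) (Nat.cast_nonneg _)
      · have hΩ : (0 : ℝ) < Fintype.card Ω := by exact_mod_cast hpos
        have h1 : ((A i ∩ N S₂).card : ℝ) * Fintype.card Ω
            ≤ x i * (∏ j ∈ Γ i, (1 - x j)) * (N S₂).card * Fintype.card Ω := by
          calc ((A i ∩ N S₂).card : ℝ) * Fintype.card Ω ≤ (A i).card * (N S₂).card := hind'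
            _ ≤ x i * (∏ j ∈ Γ i, (1 - x j)) * Fintype.card Ω * (N S₂).card :=
                mul_le_mul_of_nonneg_right (hp i hi) (Nat.cast_nonneg _)
            _ = x i * (∏ j ∈ Γ i, (1 - x j)) * (N S₂).card * Fintype.card Ω := by ring
        exact le_of_mul_le_mul_right h1 hΩ
    -- `∏_{Γ i} (1 - x) ≤ ∏_{S₁} (1 - x)` since `S₁ ⊆ Γ i` and the factors lie in `[0, 1]`
    have hS₁Γ : S₁ ⊆ Γ i := fun j hj => (mem_filter.1 hj).2
    have hprodle : ∏ j ∈ Γ i, (1 - x j) ≤ ∏ j ∈ S₁, (1 - x j) := by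
      rw [← prod_sdiff hS₁Γ]
      have h1 : ∏ j ∈ Γ i \ S₁, (1 - x j) ≤ 1 :=
        prod_le_one (fun j _ => sub_nonneg.2 (hx1 j)) fun j _ => sub_le_self _ (hx0 j)
      have h2 : 0 ≤ ∏ j ∈ S₁, (1 - x j) := prod_nonneg fun j _ => sub_nonneg.2 (hx1 j)
      calc (∏ j ∈ Γ i \ S₁, (1 - x j)) * ∏ j ∈ S₁, (1 - x j)
          ≤ 1 * ∏ j ∈ S₁, (1 - x j) := mul_le_mul_of_nonneg_right h1 h2
        _ = ∏ j ∈ S₁, (1 - x j) := one_mul _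
    -- assemble
    have hmono : (A i ∩ N S).card ≤ (A i ∩ N S₂).card :=
      card_le_card (inter_subset_inter_left (avoid_subset_avoid A hS₂S))
    calc ((A i ∩ N S).card : ℝ) ≤ (A i ∩ N S₂).card := by exact_mod_cast hmono
      _ ≤ x i * (∏ j ∈ Γ i, (1 - x j)) * (N S₂).card := hA2
      _ ≤ x i * ((∏ j ∈ S₁, (1 - x j)) * (N S₂).card) := by
          rw [mul_assoc]
          exact mul_le_mul_of_nonneg_left
            (mul_le_mul_of_nonneg_right hprodle (Nat.cast_nonneg _)) (hx0 i)
      _ ≤ x i * (N (S₂ ∪ S₁)).card :=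
          mul_le_mul_of_nonneg_left (hchain S₁ Subset.rfl) (hx0 i)
      _ = x i * (N S).card := by rw [hunion]

/-- **The lopsided Lovász Local Lemma (Erdős–Lovász 1975; Spencer 1977; Erdős–Spencer 1991),
counting form.** Under the hypotheses of `card_inter_avoid_le`, the sample points avoiding every
`A i`, `i ∈ S`, number at least `(∏ i ∈ S, (1 - x i)) · |Ω|`, for every `S ⊆ I` — in particular
for `S = I`. [cite: AlonSpencer2016, Lemma 5.1.1 and §5.7] -/
theorem lopsided_local_lemma (A : ι → Finset Ω) [∀ i, DecidablePred (· ∈ A i)]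
    (Γ : ι → Finset ι) (x : ι → ℝ) (I : Finset ι)
    (hx0 : ∀ i, 0 ≤ x i) (hx1 : ∀ i, x i ≤ 1)
    (hind : ∀ i ∈ I, ∀ S ⊆ I, i ∉ S → (∀ j ∈ S, j ∉ Γ i) →
      ((A i ∩ univ.filter fun ω => ∀ j ∈ S, ω ∉ A j).card : ℝ) * Fintype.card Ω
        ≤ (A i).card * (univ.filter fun ω => ∀ j ∈ S, ω ∉ A j).card)
    (hp : ∀ i ∈ I, ((A i).card : ℝ) ≤ x i * (∏ j ∈ Γ i, (1 - x j)) * Fintype.card Ω) :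
    ∀ S ⊆ I, (∏ i ∈ S, (1 - x i)) * (Fintype.card Ω : ℝ)
      ≤ (univ.filter fun ω => ∀ j ∈ S, ω ∉ A j).card := by
  classical
  have hkey := card_inter_avoid_le A Γ x I hx0 hx1 hind hp
  intro S
  induction S using Finset.induction_on with
  | empty =>
    intro
    have h0 : (univ.filter fun ω : Ω => ∀ j ∈ (∅ : Finset ι), ω ∉ A j) = univ :=
      filter_true_of_mem fun ω _ => by simp
    rw [h0, prod_empty, one_mul, card_univ]
  | @insert a S haS ih =>
    intro hI
    have hSI : S ⊆ I := (subset_insert a S).trans hI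
    have haI : a ∈ I := hI (mem_insert_self a S)
    have hstep := hkey S hSI a haI haS
    have hcard : ((univ.filter fun ω => ∀ j ∈ insert a S, ω ∉ A j).card : ℝ)
        = (univ.filter fun ω => ∀ j ∈ S, ω ∉ A j).card
          - (A a ∩ univ.filter fun ω => ∀ j ∈ S, ω ∉ A j).card := by
      have h := card_avoid_insert_add A S a
      have h' : ((univ.filter fun ω => ∀ j ∈ insert a S, ω ∉ A j).card : ℝ)
          + (A a ∩ univ.filter fun ω => ∀ j ∈ S, ω ∉ A j).card
          = (univ.filter fun ω => ∀ j ∈ S, ω ∉ A j).card := by exact_mod_cast h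
      linarith
    rw [prod_insert haS, hcard]
    have h1a : 0 ≤ 1 - x a := sub_nonneg.2 (hx1 a)
    calc (1 - x a) * (∏ j ∈ S, (1 - x j)) * (Fintype.card Ω : ℝ)
        = (1 - x a) * ((∏ j ∈ S, (1 - x j)) * (Fintype.card Ω : ℝ)) := by ring
      _ ≤ (1 - x a) * (univ.filter fun ω => ∀ j ∈ S, ω ∉ A j).card :=
          mul_le_mul_of_nonneg_left (ih hSI) h1a
      _ = (univ.filter fun ω => ∀ j ∈ S, ω ∉ A j).card
          - x a * (univ.filter fun ω => ∀ j ∈ S, ω ∉ A j).card := by ring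
      _ ≤ _ := by linarith [hstep]

/-- **Positive probability.** If moreover every `x i < 1` (`i ∈ I`) and `Ω` is nonempty, some
sample point lies in no `A i`. [cite: AlonSpencer2016, Lemma 5.1.1] -/
theorem exists_forall_not_mem_of_lopsided [Nonempty Ω] (A : ι → Finset Ω)
    [∀ i, DecidablePred (· ∈ A i)] (Γ : ι → Finset ι) (x : ι → ℝ) (I : Finset ι)
    (hx0 : ∀ i, 0 ≤ x i) (hx1 : ∀ i, x i ≤ 1) (hxI : ∀ i ∈ I, x i < 1)
    (hind : ∀ i ∈ I, ∀ S ⊆ I, i ∉ S → (∀ j ∈ S, j ∉ Γ i) →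
      ((A i ∩ univ.filter fun ω => ∀ j ∈ S, ω ∉ A j).card : ℝ) * Fintype.card Ω
        ≤ (A i).card * (univ.filter fun ω => ∀ j ∈ S, ω ∉ A j).card)
    (hp : ∀ i ∈ I, ((A i).card : ℝ) ≤ x i * (∏ j ∈ Γ i, (1 - x j)) * Fintype.card Ω) :
    ∃ ω : Ω, ∀ i ∈ I, ω ∉ A i := by
  classical
  have h := lopsided_local_lemma A Γ x I hx0 hx1 hind hp I Subset.rfl
  have hprod : 0 < ∏ i ∈ I, (1 - x i) := prod_pos fun i hi => sub_pos.2 (hxI i hi)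
  have hΩ : (0 : ℝ) < Fintype.card Ω := by exact_mod_cast Fintype.card_pos
  have hpos : (0 : ℝ) < (univ.filter fun ω => ∀ j ∈ I, ω ∉ A j).card :=
    lt_of_lt_of_le (mul_pos hprod hΩ) h
  have hne : (univ.filter fun ω => ∀ j ∈ I, ω ∉ A j).Nonempty := by
    rw [← Finset.card_pos]; exact_mod_cast hpos
  obtain ⟨ω, hω⟩ := hne
  exact ⟨ω, (mem_filter.1 hω).2⟩

end Lopsided

/-! ### Product spaces: events determined by disjoint sets of coordinates -/

section Product

variable {V κ : Type*} [Fintype V] [DecidableEq V] [Fintype κ] [DecidableEq κ]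

/-- **Independence across disjoint coordinates, counting form.** In the product space `V → κ`,
if membership in `A` depends only on the coordinates in `T` and membership in `B` only on the
coordinates outside `T`, then `|A ∩ B| · |Ω| ≤ |A| · |B|` (in fact equality). Proof: the mixing
map `(ω, ω') ↦ (ω on T ∪ ω' off T, ω' on T ∪ ω off T)` is injective on `Ω × Ω` and sends
`(A ∩ B) × Ω` into `A × B`. [folklore] -/
theorem card_inter_mul_card_le_of_determined (T : Finset V) (A B : Finset (V → κ))
    (hA : ∀ ω ω' : V → κ, (∀ v ∈ T, ω v = ω' v) → ω ∈ A → ω' ∈ A)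
    (hB : ∀ ω ω' : V → κ, (∀ v ∉ T, ω v = ω' v) → ω ∈ B → ω' ∈ B) :
    (A ∩ B).card * Fintype.card (V → κ) ≤ A.card * B.card := by
  classical
  set μ : (V → κ) × (V → κ) → (V → κ) × (V → κ) := fun p =>
    (fun v => if v ∈ T then p.1 v else p.2 v, fun v => if v ∈ T then p.2 v else p.1 v) with hμ
  have hinj : Function.Injective μ := by
    intro p q hpq
    have e1 : ∀ v, (μ p).1 v = (μ q).1 v := fun v => by rw [hpq]
    have e2 : ∀ v, (μ p).2 v = (μ q).2 v := fun v => by rw [hpq]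
    have h1 : p.1 = q.1 := by
      funext v
      by_cases hv : v ∈ T
      · simpa [hμ, hv] using e1 v
      · simpa [hμ, hv] using e2 v
    have h2 : p.2 = q.2 := by
      funext v
      by_cases hv : v ∈ T
      · simpa [hμ, hv] using e2 v
      · simpa [hμ, hv] using e1 v
    exact Prod.ext h1 h2
  have hmaps : ∀ p ∈ (A ∩ B) ×ˢ (univ : Finset (V → κ)), μ p ∈ A ×ˢ B := by
    intro p hp
    rw [mem_product] at hp ⊢
    obtain ⟨hp1, -⟩ := hp
    rw [mem_inter] at hp1
    refine ⟨hA p.1 (μ p).1 (fun v hv => by simp [hμ, hv]) hp1.1,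
      hB p.1 (μ p).2 (fun v hv => by simp [hμ, hv]) hp1.2⟩
  calc (A ∩ B).card * Fintype.card (V → κ)
      = ((A ∩ B) ×ˢ (univ : Finset (V → κ))).card := by rw [card_product, card_univ]
    _ ≤ (A ×ˢ B).card := card_le_card_of_injOn μ hmaps (hinj.injOn)
    _ = A.card * B.card := card_product _ _

/-- **The variable version of the Lovász Local Lemma (counting form).** Let `A i` (`i ∈ I`) be
events in the product space `V → κ` such that membership in `A i` depends only on the
coordinates in `vbl i`, and let `x i ∈ [0, 1]`. If
`|A i| ≤ x i · ∏_{j ∈ I, j ≠ i, vbl i ∩ vbl j ≠ ∅} (1 - x j) · |κ|^|V|` for every `i ∈ I`, then at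
least `(∏ i ∈ I, (1 - x i)) · |κ|^|V|` points lie in no `A i`.
[cite: AlonSpencer2016, Lemma 5.1.1 (with the mutual-independence principle of §5.2)] -/
theorem variable_local_lemma {ι : Type*} [DecidableEq ι] (I : Finset ι)
    (A : ι → Finset (V → κ)) [∀ i, DecidablePred (· ∈ A i)] (vbl : ι → Finset V)
    (hdet : ∀ i ∈ I, ∀ ω ω' : V → κ, (∀ v ∈ vbl i, ω v = ω' v) → ω ∈ A i → ω' ∈ A i)
    (x : ι → ℝ) (hx0 : ∀ i, 0 ≤ x i) (hx1 : ∀ i, x i ≤ 1)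
    (hp : ∀ i ∈ I, ((A i).card : ℝ) ≤ x i *
      (∏ j ∈ I.filter (fun j => j ≠ i ∧ ¬ Disjoint (vbl i) (vbl j)), (1 - x j)) *
        Fintype.card (V → κ)) :
    (∏ i ∈ I, (1 - x i)) * (Fintype.card (V → κ) : ℝ)
      ≤ (univ.filter fun ω : V → κ => ∀ i ∈ I, ω ∉ A i).card := by
  classical
  refine lopsided_local_lemma A (fun i => I.filter fun j => j ≠ i ∧ ¬ Disjoint (vbl i) (vbl j))
    x I hx0 hx1 ?_ hp I Subset.rfl
  intro i hi S hSI hiS hSΓ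
  -- every `j ∈ S` has coordinates disjoint from those of `i`
  have hdisj : ∀ j ∈ S, Disjoint (vbl i) (vbl j) := by
    intro j hj
    have h := hSΓ j hj
    simp only [mem_filter, not_and, not_not] at h
    exact h (hSI hj) (fun hji => hiS (hji ▸ hj))
  have h := card_inter_mul_card_le_of_determined (vbl i) (A i)
    (univ.filter fun ω : V → κ => ∀ j ∈ S, ω ∉ A j) (hdet i hi) ?_
  · exact_mod_cast h
  · intro ω ω' hagree hω
    simp only [mem_filter, mem_univ, true_and] at hω ⊢
    intro j hj hω'
    refine hω j hj (hdet j (hSI hj) ω' ω (fun v hv => ?_) hω')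
    have hvT : v ∉ vbl i := fun hvi => disjoint_left.1 (hdisj j hj) hvi hv
    exact (hagree v hvT).symm

/-- **The variable version, positive probability.** If moreover `x i < 1` for `i ∈ I` and the
space is nonempty, some point of `V → κ` lies in no `A i`.
[cite: AlonSpencer2016, Lemma 5.1.1 and Cor. 5.1.2] -/
theorem exists_forall_not_mem_of_variable {ι : Type*} [DecidableEq ι] [Nonempty κ]
    (I : Finset ι) (A : ι → Finset (V → κ)) [∀ i, DecidablePred (· ∈ A i)] (vbl : ι → Finset V)
    (hdet : ∀ i ∈ I, ∀ ω ω' : V → κ, (∀ v ∈ vbl i, ω v = ω' v) → ω ∈ A i → ω' ∈ A i)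
    (x : ι → ℝ) (hx0 : ∀ i, 0 ≤ x i) (hx1 : ∀ i, x i ≤ 1) (hxI : ∀ i ∈ I, x i < 1)
    (hp : ∀ i ∈ I, ((A i).card : ℝ) ≤ x i *
      (∏ j ∈ I.filter (fun j => j ≠ i ∧ ¬ Disjoint (vbl i) (vbl j)), (1 - x j)) *
        Fintype.card (V → κ)) :
    ∃ ω : V → κ, ∀ i ∈ I, ω ∉ A i := by
  classical
  have h := variable_local_lemma I A vbl hdet x hx0 hx1 hp
  have hprod : 0 < ∏ i ∈ I, (1 - x i) := prod_pos fun i hi => sub_pos.2 (hxI i hi)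
  have hΩ : (0 : ℝ) < Fintype.card (V → κ) := by exact_mod_cast Fintype.card_pos
  have hpos : (0 : ℝ) < (univ.filter fun ω : V → κ => ∀ i ∈ I, ω ∉ A i).card :=
    lt_of_lt_of_le (mul_pos hprod hΩ) h
  have hne : (univ.filter fun ω : V → κ => ∀ i ∈ I, ω ∉ A i).Nonempty := by
    rw [← Finset.card_pos]; exact_mod_cast hpos
  obtain ⟨ω, hω⟩ := hne
  exact ⟨ω, (mem_filter.1 hω).2⟩

end Product

end Literature.Probability.Independence
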